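import Literature.NumberTheory.Automorphic.Liu2021.Thm418CombinedReading
import Literature.RepresentationTheory.Liu2021.AlbaneseBlockMultiplicityOne
import Mathlib.RepresentationTheory.Intertwining
import HarnessLib

/-!
# [Liu 2021, Thm. 4.18] AS PRINTED + multiplicity one (proof of Prop. 4.13, l. 2145) ⟹ «block ≤ range of the proof map (4.3)»
# — Step 1 of the combined reading, RANK-ONE branch, on the as-printed record, in `ℂ[G]`-module currency

Y. Liu, *Fourier–Jacobi cycles and arithmetic relative trace formula*, Camb. J. Math. **9** (2021) 1–147 = arXiv:2102.11518
[Liu2021]; TeX source `FJcycle.tex` (md5 `6db49a74122d2cb0f224fa1b39488a0c`; `l. NNNN` = its lines).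

## What this file is (and for whom)

The cells' bridge «[Liu2021] Thm. 4.18 AS PRINTED ⟹ the combined reading r8 `Thm418Combined` / `Thm418C`» (pub-hodgecm2
HM-EQUALITY Δ2) is, in the tree, `Thm418Data.block_resW_mem_span_of_thm418AsPrinted_act` (`Liu2021/Thm418CombinedReading.lean`,
pin-3): it consumes the (4.3)-carrier `J` with its printed properties, the class identification `hpin`, and ONE more input
`hblock : block ≤ LinearMap.range J` — «the `μ`-block of `H = H¹_{B,τ'}(A_∞, ℂ)` lies in the image of the proof map (4.3)».
THIS FILE discharges `hblock` for the package's INTRINSIC block `⨆_{(ε,χ)} ⨆_{ψ : ω(μ,ε,χ) →ₗ[ℂ[G]] H} range ψ` (stage-1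
`LiuAlbaneseModuleDatum.block`/`oscImage`, with `Ωt := (D.rhoAt i).asModule` — the currency of the ported
`HodgeCM.EquivariantLift`) along the RANK-ONE branch of the derivation of record:

* `Φ : Ω(μ) ⊗_{M_μ} ℂ ≃ ⊕_{ε,χ} ω(μ,ε,χ)` with its intertwining clause — [Liu2021] Thm. 4.18, main statement, l. 2233–2237
  (`Liu2021.Thm418AsPrinted`, the consumer's obtained witness);
* `J : Ω(μ) ⊗_{M_μ} ℂ → H` — THE PROOF'S MAP (4.3) (l. 2247–2266: «`f ⊗ z ↦ z · f^*α`», `ℂ[𝔾(𝔸_F^∞)]`-linear l. 2250, injective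
  l. 2252–2262), a carrier with its two printed properties `hJ`, `hJinj` (as in `Thm418CombinedReading`);
* `hnv : ∀ i, Nontrivial (ω_i)` — each `ω(μ,ε,χ)` is a non-zero space (Def. 4.11 «irreducible admissible» l. 2092–2096 with App. D
  Lem. D.1 (1) l. 5226–5229; in the tree `Liu2021.Thm418Data.nontrivial_omega_of_localOscillator` / `LemD1AsPrinted`);
* `hmult : ∀ i, Module.rank ℂ (ω_i.asModule →ₗ[ℂ[G]] H) ≤ 1` — MULTIPLICITY ONE, [Liu2021] proof of Prop. 4.13, last sentence
  l. 2145 «the dimension of `H¹_{B,τ'}(A_∞, ℂ)[ω(μ,ε,χ)]` is `1`» (record `Liu2021.Prop413Data.MultOneAsPrinted`, typed with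
  Mathlib's bundled intertwining maps; the bridge `rank (ρ.asModule →ₗ[ℂ[G]] H) ≤ rank (IntertwiningMap ρ (ofModule' H))` to
  this file's currency is `Thm418Data.rank_linearMap_asModule_le_rank_intertwiningMap_ofModule'` below).

Conclusion (`Thm418Data.iSup_iSup_range_le_range_of_rank_le_one`; and, composed with pin-3's bridge, the CAPSTONE
`Thm418Data.iSup_range_resW_mem_span_of_thm418AsPrinted_of_rank_le_one` = the r8 shape at one `μ` with NO `Φ`/`hblock` binder,
from `Thm418AsPrinted D` + {(4.3)-carrier, hpin, hnv, hmult}):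
  `(⨆ i, ⨆ ψ : (D.rhoAt i).asModule →ₗ[ℂ[G]] H, (range ψ).restrictScalars ℂ) ≤ LinearMap.range J`.
PROOF (per summand; no decomposition of `H`, no Thm. 4.18 (2), no `MuSeparated`, no Schur): the `ℂ[G]`-linear lift `j_i` of
`J ∘ Φ⁻¹ ∘ ι_i : ω_i → H` (equivariant by the two printed intertwining clauses; Mathlib `MonoidAlgebra.equivariantOfLinearOfComm`) is
non-zero (`J`, `Φ⁻¹`, `ι_i` injective; `ω_i ≠ 0`), so by `rank ≤ 1` every `ψ : ω_i.asModule →ₗ[ℂ[G]] H` is `c • j_i` (tree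
`Literature.RepresentationTheory.Liu2021.range_le_range_of_rank_hom_le_one`) and `range ψ ⊆ range j_i ⊆ range J`.
Compared with the DECOMPOSITION branch (Prop. 4.13's iso + irreducibility + pairwise non-isomorphy of ALL summands incl. across
characters `μ' ≠ μ`), this branch consumes ONE printed sentence (l. 2145) — b01-idea-1's Δ2 ledger, item (M1), «rank-one branch
recommended».  Theorems only: no definition, no instance, no named fact,
nothing asserted about Liu's objects; `J`, `hJ`, `hJinj`, `hnv`, `hmult` remain the consumer's (records + pins).  HC_CM is NOT proved.
Seat prover-pub-hodgecm2-tr-prover-6-g3-0 (item-(vi) END-display lineage), 2026-08-21.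

## References
* [Liu2021] Thm. 4.18 (l. 2232–2245) with its proof, map (4.3) (l. 2247–2266); Prop. 4.13 (l. 2113–2119) with proof l. 2145;
  Def. 4.11 (l. 2083–2097); App. D Lem. D.1 (1) (l. 5226–5229).
* Tree: `Liu2021.Thm418AsPrinted`, `Liu2021.Thm418CombinedReading` (pin-3), `Liu2021.Prop413MultOneAsPrinted` (M1),
  `Literature.RepresentationTheory.Liu2021.range_le_range_of_rank_hom_le_one` (`AlbaneseBlockMultiplicityOne.lean`),
  ported `HodgeCM.EquivariantLift` (`Summits/HodgeConjecture/HodgeCM/Model/Binders/EquivariantLift.lean`, same `lift`).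
-/

noncomputable section

open NumberField TensorProduct DirectSum

namespace Literature.NumberTheory.Automorphic.Liu2021

/-! ## §0  Currency: `ℂ[G]`-linear maps on `ρ.asModule` vs. bundled intertwining maps into `ofModule' H` (private plumbing) -/

section Currency

variable {k G : Type*} [Field k] [Group G]
  {V : Type*} [AddCommGroup V] [Module k V] (ρ : Representation k G V)
  {H : Type*} [AddCommGroup H] [Module k H] [Module (MonoidAlgebra k G) H] [IsScalarTower k (MonoidAlgebra k G) H]

/-- `Representation.ofModule' H g h = of g • h`. [folklore] -/
private theorem ofModule'_apply_eq (g : G) (h : H) :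
    Representation.ofModule' (k := k) H g h = MonoidAlgebra.of k G g • h := by
  simp only [Representation.ofModule', MonoidAlgebra.lift_symm_apply, Algebra.lsmul_coe, MonoidAlgebra.of_apply]

/-- A `k[G]`-linear map `ψ : ρ.asModule → H`, read as a `k`-linear map `V → H`, intertwines `ρ` with `ofModule' H`. [folklore] -/
private theorem restrictScalars_asModule_intertwining (ψ : ρ.asModule →ₗ[MonoidAlgebra k G] H) (g : G) (v : V) :
    (ψ.restrictScalars k ∘ₗ ρ.asModuleEquiv.symm.toLinearMap) (ρ g v) =
      Representation.ofModule' (k := k) H g ((ψ.restrictScalars k ∘ₗ ρ.asModuleEquiv.symm.toLinearMap) v) := by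
  simp only [LinearMap.coe_comp, LinearEquiv.coe_coe, Function.comp_apply, LinearMap.coe_restrictScalars,
    Representation.asModuleEquiv_symm_map_rho, map_smul, ofModule'_apply_eq]

/-- **Currency comparison**: the `k`-rank of the `k[G]`-linear maps `ρ.asModule → H` is at most that of the bundled
intertwining maps `ρ → ofModule' H` (in fact equal; `≤` is what transports a rank bound): `ψ ↦ ψ|_V` is an injective
`k`-linear map between the two spaces. [folklore] -/
private theorem rank_linearMap_asModule_le_rank_intertwiningMap :
    Module.rank k (ρ.asModule →ₗ[MonoidAlgebra k G] H) ≤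
      Module.rank k (Representation.IntertwiningMap ρ (Representation.ofModule' (k := k) H)) := by
  let T : (ρ.asModule →ₗ[MonoidAlgebra k G] H) →ₗ[k]
      Representation.IntertwiningMap ρ (Representation.ofModule' (k := k) H) :=
    { toFun := fun ψ => (ψ.restrictScalars k ∘ₗ ρ.asModuleEquiv.symm.toLinearMap).intertwiningMap_of_isIntertwiningMap _ _
        (restrictScalars_asModule_intertwining ρ ψ)
      map_add' := fun ψ₁ ψ₂ => by ext v; rfl
      map_smul' := fun c ψ => by ext v; rfl }
  refine LinearMap.rank_le_of_injective T fun ψ₁ ψ₂ h => ?_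
  ext v
  have hv := DFunLike.congr_fun h (ρ.asModuleEquiv v)
  simpa [T] using hv

end Currency

/-! ## §1  `block ≤ range (4.3)` from Thm. 4.18 as printed + multiplicity one, on the record -/

namespace Thm418Data

variable {F E : Type} [Field F] [NumberField F] [IsTotallyReal F] [Field E] [NumberField E] [Algebra F E]
  [IsTotallyComplex E] [Algebra.IsQuadraticExtension F E] {D : Thm418Data F E}
  {H : Type*} [AddCommGroup H] [Module ℂ H] [Module (MonoidAlgebra ℂ D.G) H] [IsScalarTower ℂ (MonoidAlgebra ℂ D.G) H]

/-- **Currency bridge for the multiplicity-one record.**  For the consumer's `ℂ[𝔾(𝔸_F^∞)]`-module `H` (the tower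
`H¹_{B,τ'}(A_∞, ℂ)`), the `ℂ`-rank of the `ℂ[G]`-linear maps `ω_i.asModule → H` is at most that of the bundled intertwining maps
`ω_i → ofModule' H`; so the record `Prop413Data.MultOneAsPrinted` ([Liu2021] proof of Prop. 4.13, l. 2145: «the dimension of
`H¹_{B,τ'}(A_∞, ℂ)[ω(μ,ε,χ)]` is `1`»), typed at `P.rhoB τ' := Representation.ofModule' H`, yields the hypothesis `hmult` below.
[cite: Liu2021, Prop. 4.13, proof l. 2145] -/
theorem rank_linearMap_asModule_le_rank_intertwiningMap_ofModule' (i : D.AdmIndex) :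
    Module.rank ℂ ((D.rhoAt i).asModule →ₗ[MonoidAlgebra ℂ D.G] H) ≤
      Module.rank ℂ (Representation.IntertwiningMap (D.rhoAt i) (Representation.ofModule' (k := ℂ) H)) :=
  rank_linearMap_asModule_le_rank_intertwiningMap (D.rhoAt i)

section BlockLeRange

variable (Φ : (ℂ ⊗[fieldOfValues E D.μ] D.Ω) ≃ₗ[ℂ] (⨁ i : D.AdmIndex, D.omegaAt i))

/-- Equivariance of `Φ⁻¹` on a single summand: `Φ⁻¹ (ι_i (g · v)) = (g ⊗ 1) · Φ⁻¹ (ι_i v)`, from the printed intertwining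
clause of [Liu2021] Thm. 4.18 («isomorphism … of `ℂ[𝔾(𝔸_F^∞)]`-modules», l. 2233–2237). [cite: Liu2021, Thm. 4.18 (l. 2233–2237)] -/
theorem symm_lof_rhoAt [DecidableEq D.AdmIndex]
    (hΦ : ∀ (g : D.G) (x : ℂ ⊗[fieldOfValues E D.μ] D.Ω) (i : D.AdmIndex),
      Φ ((D.rhoΩ g).baseChange ℂ x) i = D.rhoAt i g (Φ x i))
    (i : D.AdmIndex) (g : D.G) (v : D.omegaAt i) :
    Φ.symm (DirectSum.lof ℂ D.AdmIndex D.omegaAt i (D.rhoAt i g v)) =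
      (D.rhoΩ g).baseChange ℂ (Φ.symm (DirectSum.lof ℂ D.AdmIndex D.omegaAt i v)) := by
  apply Φ.injective
  rw [LinearEquiv.apply_symm_apply]
  refine DFinsupp.ext fun s => ?_
  rw [hΦ g _ s, LinearEquiv.apply_symm_apply]
  by_cases hsi : s = i
  · subst hsi
    simp only [DirectSum.lof_eq_of, DirectSum.of_eq_same]
  · rw [DirectSum.lof_eq_of, DirectSum.lof_eq_of, DirectSum.of_eq_of_ne _ _ _ hsi, DirectSum.of_eq_of_ne _ _ _ hsi, map_zero]

/-- **STEP 1 (rank-one branch) on the as-printed record, `ℂ[G]`-module currency.**  Data: the printed isomorphism `Φ` with its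
intertwining clause ([Liu2021] Thm. 4.18, l. 2233–2237 — the consumer's witness from `Thm418AsPrinted D`); the consumer's
`ℂ[𝔾(𝔸_F^∞)]`-module `H` (= `H¹_{B,τ'}(A_∞, ℂ)`); THE PROOF'S MAP (4.3) `J : Ω(μ) ⊗_{M_μ} ℂ → H` with its printed properties `hJ`
(«`ℂ[𝔾(𝔸_F^∞)]`-linear», l. 2250) and `hJinj` (injective, l. 2252–2262); `hnv` — every `ω(μ,ε,χ)` is non-zero (Def. 4.11 with
App. D Lem. D.1 (1)); `hmult` — MULTIPLICITY ONE (proof of Prop. 4.13, l. 2145: «the dimension of `H¹_{B,τ'}(A_∞, ℂ)[ω(μ,ε,χ)]`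
is `1`», record `Prop413Data.MultOneAsPrinted` through `rank_linearMap_asModule_le_rank_intertwiningMap_ofModule'`).  CONCLUSION: the
intrinsic `μ`-block `⨆_i ⨆_{ψ : ω_i.asModule →ₗ[ℂ[G]] H} range ψ` (the stage-1 package's `block μ`, `oscImage` with
`Ωt := (D.rhoAt i).asModule`) lies in the range of `J` — the hypothesis `hblock` of `Thm418Data.block_resW_mem_span_of_thm418AsPrinted_act`
(`Thm418CombinedReading.lean`).  Per-summand proof: the `ℂ[G]`-linear lift of `J ∘ Φ⁻¹ ∘ ι_i` is a non-zero element of the rank-`≤ 1`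
space `Hom_{ℂ[G]}(ω_i.asModule, H)`, so every `ψ` there is a scalar multiple of it
(`Literature.RepresentationTheory.Liu2021.range_le_range_of_rank_hom_le_one`).  No decomposition of `H`, no Thm. 4.18 (2), no
cross-character separation is used.  HC_CM is NOT proved; `J`/`hJ`/`hJinj`/`hnv`/`hmult` remain the consumer's.
[cite: Liu2021, Thm. 4.18 (l. 2233–2237) with proof map (4.3) (l. 2247–2266); Prop. 4.13, proof l. 2145; Def. 4.11] -/
theorem iSup_iSup_range_le_range_of_rank_le_one
    (hΦ : ∀ (g : D.G) (x : ℂ ⊗[fieldOfValues E D.μ] D.Ω) (i : D.AdmIndex),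
      Φ ((D.rhoΩ g).baseChange ℂ x) i = D.rhoAt i g (Φ x i))
    (J : ℂ ⊗[fieldOfValues E D.μ] D.Ω →ₗ[ℂ] H)
    (hJ : ∀ (g : D.G) (x : ℂ ⊗[fieldOfValues E D.μ] D.Ω), J ((D.rhoΩ g).baseChange ℂ x) = MonoidAlgebra.of ℂ D.G g • J x)
    (hJinj : Function.Injective J) (hnv : ∀ i : D.AdmIndex, Nontrivial (D.omegaAt i))
    (hmult : ∀ i : D.AdmIndex, Module.rank ℂ ((D.rhoAt i).asModule →ₗ[MonoidAlgebra ℂ D.G] H) ≤ 1) :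
    (⨆ i : D.AdmIndex, ⨆ ψ : (D.rhoAt i).asModule →ₗ[MonoidAlgebra ℂ D.G] H, (LinearMap.range ψ).restrictScalars ℂ) ≤
      LinearMap.range J := by
  classical
  refine iSup_le fun i => iSup_le fun ψ => ?_
  -- the summand map `f_i := J ∘ Φ⁻¹ ∘ ι_i : ω_i → H`, equivariant and injective
  let f : D.omegaAt i →ₗ[ℂ] H := J ∘ₗ Φ.symm.toLinearMap ∘ₗ DirectSum.lof ℂ D.AdmIndex D.omegaAt i
  have hf : ∀ (g : D.G) (v : D.omegaAt i), f (D.rhoAt i g v) = MonoidAlgebra.of ℂ D.G g • f v := by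
    intro g v
    simp only [f, LinearMap.coe_comp, LinearEquiv.coe_coe, Function.comp_apply]
    rw [symm_lof_rhoAt Φ hΦ i g v, hJ]
  have hfinj : Function.Injective f := fun a b hab =>
    DirectSum.of_injective (β := fun s => D.omegaAt s) i (Φ.symm.injective (hJinj hab))
  haveI : Nontrivial (D.omegaAt i) := hnv i
  -- its `ℂ[G]`-linear lift `j` (`MonoidAlgebra.equivariantOfLinearOfComm` after `asModuleEquiv`, the ported
  -- `HodgeCM.EquivariantLift.lift`): `j v = f (asModuleEquiv v)`
  let j : (D.rhoAt i).asModule →ₗ[MonoidAlgebra ℂ D.G] H :=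
    MonoidAlgebra.equivariantOfLinearOfComm (f ∘ₗ (D.rhoAt i).asModuleEquiv.toLinearMap) fun g v => by
      simp only [LinearMap.coe_comp, LinearEquiv.coe_coe, Function.comp_apply, Representation.asModuleEquiv_map_smul,
        Representation.asAlgebraHom_single, one_smul, hf, MonoidAlgebra.of_apply]
  have hj_apply : ∀ v : (D.rhoAt i).asModule, j v = f ((D.rhoAt i).asModuleEquiv v) := fun v => rfl
  -- `j ≠ 0` (`f` injective, `ω_i ≠ 0`), so by rank `≤ 1` every `ψ` is a multiple of `j`: `range ψ ⊆ range j = range f ⊆ range J`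
  have hj0 : j ≠ 0 := by
    obtain ⟨v, hv⟩ := exists_ne (0 : D.omegaAt i)
    intro h0
    have h1 : f v = 0 := by
      have := LinearMap.congr_fun h0 ((D.rhoAt i).asModuleEquiv.symm v)
      rw [hj_apply, LinearEquiv.apply_symm_apply, LinearMap.zero_apply] at this
      exact this
    exact hv (hfinj (by rw [h1, map_zero]))
  have hle : LinearMap.range ψ ≤ LinearMap.range j :=
    Literature.RepresentationTheory.Liu2021.range_le_range_of_rank_hom_le_one (hmult i) hj0 ψ
  intro x hx
  obtain ⟨w, hw⟩ := LinearMap.mem_range.1 (hle hx)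
  rw [← hw, hj_apply]
  exact ⟨Φ.symm (DirectSum.lof ℂ D.AdmIndex D.omegaAt i ((D.rhoAt i).asModuleEquiv w)), rfl⟩

/-- **The same with multiplicity one in the record's currency** (bundled intertwining maps into `ofModule' H`, as
`Prop413Data.MultOneAsPrinted` is typed when the consumer pins `P.rhoB τ' := Representation.ofModule' H`).
[cite: Liu2021, Thm. 4.18 (l. 2233–2237) with proof map (4.3) (l. 2247–2266); Prop. 4.13, proof l. 2145; Def. 4.11] -/
theorem iSup_iSup_range_le_range_of_rank_intertwiningMap_le_one
    (hΦ : ∀ (g : D.G) (x : ℂ ⊗[fieldOfValues E D.μ] D.Ω) (i : D.AdmIndex),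
      Φ ((D.rhoΩ g).baseChange ℂ x) i = D.rhoAt i g (Φ x i))
    (J : ℂ ⊗[fieldOfValues E D.μ] D.Ω →ₗ[ℂ] H)
    (hJ : ∀ (g : D.G) (x : ℂ ⊗[fieldOfValues E D.μ] D.Ω), J ((D.rhoΩ g).baseChange ℂ x) = MonoidAlgebra.of ℂ D.G g • J x)
    (hJinj : Function.Injective J) (hnv : ∀ i : D.AdmIndex, Nontrivial (D.omegaAt i))
    (hmult : ∀ i : D.AdmIndex,
      Module.rank ℂ (Representation.IntertwiningMap (D.rhoAt i) (Representation.ofModule' (k := ℂ) H)) ≤ 1) :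
    (⨆ i : D.AdmIndex, ⨆ ψ : (D.rhoAt i).asModule →ₗ[MonoidAlgebra ℂ D.G] H, (LinearMap.range ψ).restrictScalars ℂ) ≤
      LinearMap.range J :=
  iSup_iSup_range_le_range_of_rank_le_one Φ hΦ J hJ hJinj hnv fun i =>
    (rank_linearMap_asModule_le_rank_intertwiningMap_ofModule' (H := H) i).trans (hmult i)

end BlockLeRange

/-! ## §2  Capstone: the combined reading r8 at one `μ` from the as-printed records — NO `Φ`, NO `hblock` binder left -/

/-- **[Liu2021] Thm. 4.18 AS PRINTED ⟹ the combined reading r8 (`Thm418Combined` shape) at one `μ`, RANK-ONE branch, on the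
record.**  Composition of pin-3's `block_resW_mem_span_of_thm418AsPrinted_act` (item (1) of the printed statement + the (4.3)
carrier ⟹ the `hmap` clause) with `iSup_iSup_range_le_range_of_rank_le_one` above (the printed isomorphism `Φ` — obtained HERE
from `h : Thm418AsPrinted D`, no longer a binder — + multiplicity one ⟹ `hblock`).  REMAINING BINDERS, each a record or a pin and
nothing else: `h` = [Liu2021] Thm. 4.18 EXACTLY AS PRINTED (`Liu2021.Thm418AsPrinted`, p277833); `Dμ` = an object of `𝒜(μ)` (Prop. 4.6
(1), `Prop46_1AsPrinted`); the level family `Kof` (open compact, monotone, cofinal — §4.2 l. 2060 «sufficiently small»); the consumer's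
`ℂ[𝔾(𝔸_F^∞)]`-module `H = H¹_{B,τ'}(A_∞, ℂ)` with its geometric side `resW`/`cmCl`; THE PROOF'S MAP (4.3) `J` with `hJ`
(«`ℂ[𝔾(𝔸_F^∞)]`-linear», l. 2250) and `hJinj` (l. 2252–2262); the class identification `hpin` (Lem. 2.4 (1), l. 1210–1213 +
functoriality; an object pin); `hnv` (Def. 4.11 / App. D Lem. D.1 (1): every `ω(μ,ε,χ) ≠ 0`); `hmult` (proof of Prop. 4.13, l. 2145,
record `Prop413Data.MultOneAsPrinted` via `rank_linearMap_asModule_le_rank_intertwiningMap_ofModule'`).  CONCLUSION = the package's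
`Thm418Combined res cmCl` at this `μ` with `block μ := ⨆_i ⨆_{ψ : ω_i.asModule →ₗ[ℂ[G]] H} range ψ` and `fixedBy (Kof K) H` unfolded to
`∀ k ∈ Kof K, of k • x = x`.  HC_CM is NOT proved; no pin is discharged here.
[cite: Liu2021, Thm. 4.18 (l. 2232–2245) with proof map (4.3) (l. 2247–2266); Prop. 4.13, proof l. 2145; Lem. 2.4 (1) (l. 1210–1213); Def. 4.11] -/
theorem iSup_range_resW_mem_span_of_thm418AsPrinted_of_rank_le_one (h : Liu2021.Thm418AsPrinted D) (Dμ : D.Obj)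
    {Lvl : Type*} [Preorder Lvl] (Kof : Lvl → Subgroup D.G)
    (hmono : ∀ ⦃K K' : Lvl⦄, K ≤ K' → Kof K ≤ Kof K') (hoc : ∀ K : Lvl, IsOpenCompact (Kof K))
    (hcof : ∀ K' : Subgroup D.G, IsOpenCompact K' → ∃ K₀ : Lvl, Kof K₀ ≤ K')
    {W : Lvl → Type*} [∀ K, AddCommGroup (W K)] [∀ K, Module ℂ (W K)]
    (resW : ∀ K : Lvl, H →ₗ[ℂ] W K) (cmCl : ∀ K : Lvl, Set (W K))
    (J : ℂ ⊗[fieldOfValues E D.μ] D.Ω →ₗ[ℂ] H)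
    (hJ : ∀ (g : D.G) (x : ℂ ⊗[fieldOfValues E D.μ] D.Ω), J ((D.rhoΩ g).baseChange ℂ x) = MonoidAlgebra.of ℂ D.G g • J x)
    (hJinj : Function.Injective J)
    (hpin : ∀ (K : Lvl) (φ : D.HomK (Kof K) Dμ),
      resW K (J ((1 : ℂ) ⊗ₜ[fieldOfValues E D.μ] D.res (Kof K) Dμ φ)) ∈ cmCl K)
    (hnv : ∀ i : D.AdmIndex, Nontrivial (D.omegaAt i))
    (hmult : ∀ i : D.AdmIndex, Module.rank ℂ ((D.rhoAt i).asModule →ₗ[MonoidAlgebra ℂ D.G] H) ≤ 1) :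
    ∃ K₀ : Lvl, ∀ K ≤ K₀,
      ∀ x ∈ (⨆ i : D.AdmIndex, ⨆ ψ : (D.rhoAt i).asModule →ₗ[MonoidAlgebra ℂ D.G] H, (LinearMap.range ψ).restrictScalars ℂ),
        (∀ k ∈ Kof K, MonoidAlgebra.of ℂ D.G k • x = x) → resW K x ∈ Submodule.span ℂ (cmCl K) := by
  obtain ⟨Φ, hΦ, -⟩ := id h
  exact block_resW_mem_span_of_thm418AsPrinted_act h Dμ Kof hmono hoc hcof (fun g x => MonoidAlgebra.of ℂ D.G g • x)
    resW cmCl J hJ hJinj hpin _ (iSup_iSup_range_le_range_of_rank_le_one Φ hΦ J hJ hJinj hnv hmult)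

/-- **The same with multiplicity one in the record's currency** (bundled intertwining maps into `ofModule' H`, i.e. LITERALLY
`Prop413Data.MultOneAsPrinted.rank_intertwiningMap_le_one` at the consumer's pin `P.HB τ' := H`, `P.rhoB τ' := Representation.ofModule' H`).
[cite: Liu2021, Thm. 4.18 (l. 2232–2245) with proof map (4.3) (l. 2247–2266); Prop. 4.13, proof l. 2145; Lem. 2.4 (1) (l. 1210–1213); Def. 4.11] -/
theorem iSup_range_resW_mem_span_of_thm418AsPrinted_of_rank_intertwiningMap_le_one (h : Liu2021.Thm418AsPrinted D)
    (Dμ : D.Obj) {Lvl : Type*} [Preorder Lvl] (Kof : Lvl → Subgroup D.G)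
    (hmono : ∀ ⦃K K' : Lvl⦄, K ≤ K' → Kof K ≤ Kof K') (hoc : ∀ K : Lvl, IsOpenCompact (Kof K))
    (hcof : ∀ K' : Subgroup D.G, IsOpenCompact K' → ∃ K₀ : Lvl, Kof K₀ ≤ K')
    {W : Lvl → Type*} [∀ K, AddCommGroup (W K)] [∀ K, Module ℂ (W K)]
    (resW : ∀ K : Lvl, H →ₗ[ℂ] W K) (cmCl : ∀ K : Lvl, Set (W K))
    (J : ℂ ⊗[fieldOfValues E D.μ] D.Ω →ₗ[ℂ] H)
    (hJ : ∀ (g : D.G) (x : ℂ ⊗[fieldOfValues E D.μ] D.Ω), J ((D.rhoΩ g).baseChange ℂ x) = MonoidAlgebra.of ℂ D.G g • J x)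
    (hJinj : Function.Injective J)
    (hpin : ∀ (K : Lvl) (φ : D.HomK (Kof K) Dμ),
      resW K (J ((1 : ℂ) ⊗ₜ[fieldOfValues E D.μ] D.res (Kof K) Dμ φ)) ∈ cmCl K)
    (hnv : ∀ i : D.AdmIndex, Nontrivial (D.omegaAt i))
    (hmult : ∀ i : D.AdmIndex,
      Module.rank ℂ (Representation.IntertwiningMap (D.rhoAt i) (Representation.ofModule' (k := ℂ) H)) ≤ 1) :
    ∃ K₀ : Lvl, ∀ K ≤ K₀,
      ∀ x ∈ (⨆ i : D.AdmIndex, ⨆ ψ : (D.rhoAt i).asModule →ₗ[MonoidAlgebra ℂ D.G] H, (LinearMap.range ψ).restrictScalars ℂ),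
        (∀ k ∈ Kof K, MonoidAlgebra.of ℂ D.G k • x = x) → resW K x ∈ Submodule.span ℂ (cmCl K) :=
  iSup_range_resW_mem_span_of_thm418AsPrinted_of_rank_le_one h Dμ Kof hmono hoc hcof resW cmCl J hJ hJinj hpin hnv fun i =>
    (rank_linearMap_asModule_le_rank_intertwiningMap_ofModule' (H := H) i).trans (hmult i)

end Thm418Data

end Literature.NumberTheory.Automorphic.Liu2021

end
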